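import Summits.QuantumFields.YangMills.Theorems.MirrorModularBoostsCurvatureBoostCovarianceRayPositivity

/-!
# Ray positivity of the doubled pencils from LOCAL boost vectors — stub `stub_rayPositivityLocal`

Line `Sketch` of crux `MirrorModularBoosts.SoftKernelBoostCovariance` (stmt-QuantumFields-14999),
stub `stub_rayPositivityLocal` of the registered skeleton
`Cruxes/SoftKernelBoostCovariance/Lines/Sketch.lean`.  It is the landed Stub 4
`stub_rayPositivity` of the parent crux (`…CurvatureBoostCovarianceRayPositivity.lean`, imported
here) re-assembled with a LOCAL analytic input: instead of boosted OS vectors for ALL eight-frame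
families with the planar cone (the universal first hypothesis of `stub_rayPositivity`), only
boosted OS vectors for the `e₀`-reconstructions of the given family `S₁` and of its `45°` pull-back
`T = 𝔖 ∘ (R_{π/4} ·)` are assumed (they are what the line's operator chain produces), and the cone
hypotheses are dropped (they only fed the universal input).

Statement (`stub_rayPositivityLocal`, the registered signature verbatim).  Let `S₁` be a
one-species family on `ℝ⁴` with the OS package, translations on `⁰𝒮` and reflection positivity in
the eight planar frames.  HYPOTHESES (local boost vectors): for every `e₀`-reconstruction `h` of
`S₁` (`OSReconstructionNoE1`) and every compactly supported `e₀`-time-ordered `F` there are `ε > 0`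
and `V : ℂ → h.Hilbert` holomorphic on the strip `{|Re θ| < ε}`, of exponential type in `Im θ`, with
`V θ = Ψ_{R_θ F}` for real `|θ| < ε` (`R_θ = planeRot 0 θ`); and the same for every
`e₀`-reconstruction `h'` of the pull-back family `n ↦ 𝔖ₙ ∘ (R_{π/4} ·)`.  CONCLUSION: for compactly
supported `e₀`-time-ordered `F` (degree `n`) and `G` (degree `m`) with witnesses
`HFF, HFG, HGF, HGG` of the doubled blocks `ΘF*⊗F, ΘF*⊗G, ΘG*⊗F, ΘG*⊗G` whose orbit functions
`θ ↦ 𝔖(R_θ H)` are trigonometric polynomials in `e^{4iθ}` with coefficients `p, q, q', r`: for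
every real `s ≠ 0` and all `v, w ∈ ℂ` the `2 × 2` Laurent pencil
`v̄v P(s) + v̄w Q(s) + w̄v Q'(s) + w̄w R(s)` is real and `≥ 0`.

Proof (mechanical re-assembly of the landed proof of `stub_rayPositivity`).
* `RayPositivityLocal.axis_half` — the landed `RayPositivity.axis_half` with its universal
  boosted-vector hypothesis replaced by boost vectors for ONE family `S'` and ONE reconstruction
  `h'`: shrink `ε` below the rotation margins of the two compact supports
  (`exists_isTimeOrdered_planeRot`), identify the four orbit functions with the real-segment Gram
  pairings `⟪V_•(-θ), V_•(θ)⟫` (`orbit_eq_inner`), and conclude at every `s > 0` by the landed core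
  `stub_rayPositivityCore` (identity theorem on the strip + Gram form at the imaginary angle).
* `s > 0`: `axis_half` for `S₁` and its `e₀`-reconstruction `osReconstruction_of` (E2 from the OS
  package, translations).
* `s < 0`: `axis_half` for the pull-back `T`, which is `e₀`-reflection positive
  (`isReflectionPositive_pullBack`: `EightFrameRP` at the frame `R_{π/4}`) and translation invariant
  (`translations_pullBack`); its orbit coefficients are `(-1)^k c_k` (`orbit_pullBack`) and at the
  ray `-s > 0` the twist cancels, `(-1)^k c_k (-s)^k = c_k s^k` (`twist_cancel`).

References: Osterwalder–Schrader, *Axioms for Euclidean Green's functions* (1973), §4;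
Glimm–Jaffe, *Quantum Physics* (1987), §6.1.
-/

noncomputable section

namespace Summit.QuantumFields.YangMills.Theorems.SoftKernelBoostCovariance.Sketch

open scoped BigOperators SchwartzMap InnerProductSpace ComplexConjugate
open MeasureTheory Filter Topology
open Literature.MathematicalPhysics.QuantumLattice Literature.MathematicalPhysics.AQFT
  Literature.MathematicalPhysics.QuantumFieldTheory
open Summit.QuantumFields.YangMills.Theorems.NPointIsotropy.Negative (E4)
open Summit.QuantumFields.YangMills.Theorems.CurvatureBoostCovariance.Negative
  (OSPackage Translations EightFrameRP)
open Summit.QuantumFields.YangMills.Theorems.CurvatureBoostCovariance.BoostsInheritMirrors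
  (stub_rayPositivityCore)
open Summit.QuantumFields.YangMills.Theorems.CurvatureBoostCovariance.BoostsInheritMirrors.RayPositivity
  (osReconstruction_of translations_pullBack isReflectionPositive_pullBack orbit_pullBack twist_cancel
    exists_isTimeOrdered_planeRot orbit_eq_inner)

namespace RayPositivityLocal

/-! ## The axis rays for ONE family, from its own boosted vectors -/

/-- **The axis rays (`s > 0`) for a family with LOCAL boosted vectors.**  For a family `S'` with an
`e₀`-reconstruction `h'` (E2 along `e₀` + translations) whose compactly supported `e₀`-time-ordered
test functions all have boosted OS vectors in `h'.Hilbert` (holomorphic on a strip, equal to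
`Ψ_{R_θ F}` on the real segment), and the four doubled orbit trigonometric polynomials: the pencil is
real and `≥ 0` at every `s > 0`.  (The landed `RayPositivity.axis_half` with its universal hypothesis
made local; identical body.) -/
theorem axis_half {S' : SchwingerFamily E4} (h' : OSReconstructionNoE1 S'.toLabelled)
    (hloc : ∀ (n : ℕ) (F : SchwartzMap (Fin n → E4) ℂ), IsTimeOrdered F →
      HasCompactSupport (F : (Fin n → E4) → ℂ) →
      ∃ ε : ℝ, 0 < ε ∧ ∃ (V : ℂ → h'.Hilbert) (C N : ℝ),
        DifferentiableOn ℂ V {θ : ℂ | |θ.re| < ε} ∧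
        (∀ θ : ℂ, |θ.re| < ε → ‖V θ‖ ≤ C * Real.exp (N * |θ.im|)) ∧
        ∀ θ : ℝ, |θ| < ε → ∀ hθ : IsTimeOrdered (linActMulti (planeRot (0 : Fin 3) θ) F),
          V θ = h'.fieldVec n (fun _ => ()) (linActMulti (planeRot (0 : Fin 3) θ) F) hθ)
    {n m : ℕ} {F : 𝓢((Fin n → E4), ℂ)} {G : 𝓢((Fin m → E4), ℂ)}
    (hF : IsTimeOrdered F) (hG : IsTimeOrdered G)
    (hFc : HasCompactSupport (F : (Fin n → E4) → ℂ)) (hGc : HasCompactSupport (G : (Fin m → E4) → ℂ))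
    {HFF : 𝓢((Fin (n + n) → E4), ℂ)} {HFG : 𝓢((Fin (n + m) → E4), ℂ)}
    {HGF : 𝓢((Fin (m + n) → E4), ℂ)} {HGG : 𝓢((Fin (m + m) → E4), ℂ)}
    (hHFF : IsAppendTensorOf HFF (osAdjoint F) F) (hHFG : IsAppendTensorOf HFG (osAdjoint F) G)
    (hHGF : IsAppendTensorOf HGF (osAdjoint G) F) (hHGG : IsAppendTensorOf HGG (osAdjoint G) G)
    (Kp Kq Kq' Kr : ℕ) (p q q' r : ℤ → ℂ)
    (hp : ∀ θ : ℝ, S' (n + n) (linActMulti (planeRot (0 : Fin 3) θ) HFF) =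
      ∑ k ∈ Finset.Icc (-(Kp : ℤ)) Kp, p k * Complex.exp (4 * (k : ℂ) * (θ : ℂ) * Complex.I))
    (hq : ∀ θ : ℝ, S' (n + m) (linActMulti (planeRot (0 : Fin 3) θ) HFG) =
      ∑ k ∈ Finset.Icc (-(Kq : ℤ)) Kq, q k * Complex.exp (4 * (k : ℂ) * (θ : ℂ) * Complex.I))
    (hq' : ∀ θ : ℝ, S' (m + n) (linActMulti (planeRot (0 : Fin 3) θ) HGF) =
      ∑ k ∈ Finset.Icc (-(Kq' : ℤ)) Kq', q' k * Complex.exp (4 * (k : ℂ) * (θ : ℂ) * Complex.I))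
    (hr : ∀ θ : ℝ, S' (m + m) (linActMulti (planeRot (0 : Fin 3) θ) HGG) =
      ∑ k ∈ Finset.Icc (-(Kr : ℤ)) Kr, r k * Complex.exp (4 * (k : ℂ) * (θ : ℂ) * Complex.I))
    (s : ℝ) (hs : 0 < s) (v w : ℂ) :
    (fun z : ℂ => 0 ≤ z.re ∧ z.im = 0)
      ((∑ k ∈ Finset.Icc (-(Kp : ℤ)) Kp, starRingEnd ℂ v * v * (p k * (s : ℂ) ^ k)) +
      (∑ k ∈ Finset.Icc (-(Kq : ℤ)) Kq, starRingEnd ℂ v * w * (q k * (s : ℂ) ^ k)) +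
      (∑ k ∈ Finset.Icc (-(Kq' : ℤ)) Kq', starRingEnd ℂ w * v * (q' k * (s : ℂ) ^ k)) +
      (∑ k ∈ Finset.Icc (-(Kr : ℤ)) Kr, starRingEnd ℂ w * w * (r k * (s : ℂ) ^ k))) := by
  -- adapted from the landed `RayPositivity.axis_half` (universal hypothesis made local)
  obtain ⟨εF, hεF, VF, -, -, hVFd, -, hVF⟩ := hloc n F hF hFc
  obtain ⟨εG, hεG, VG, -, -, hVGd, -, hVG⟩ := hloc m G hG hGc
  obtain ⟨δF, hδF, hTF⟩ := exists_isTimeOrdered_planeRot hF hFc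
  obtain ⟨δG, hδG, hTG⟩ := exists_isTimeOrdered_planeRot hG hGc
  set ε : ℝ := min (min εF εG) (min δF δG)
  have hε : 0 < ε := lt_min (lt_min hεF hεG) (lt_min hδF hδG)
  have hεF' : ε ≤ εF := (min_le_left _ _).trans (min_le_left _ _)
  have hεG' : ε ≤ εG := (min_le_left _ _).trans (min_le_right _ _)
  have hδF' : ε ≤ δF := (min_le_right _ _).trans (min_le_left _ _)
  have hδG' : ε ≤ δG := (min_le_right _ _).trans (min_le_right _ _)
  have hVFd' : DifferentiableOn ℂ VF {θ : ℂ | |θ.re| < ε} :=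
    hVFd.mono fun θ (hθ : |θ.re| < ε) => lt_of_lt_of_le hθ hεF'
  have hVGd' : DifferentiableOn ℂ VG {θ : ℂ | |θ.re| < ε} :=
    hVGd.mono fun θ (hθ : |θ.re| < ε) => lt_of_lt_of_le hθ hεG'
  -- time-ordering of the rotated factors and the identification with the boosted vectors
  have tF : ∀ θ : ℝ, |θ| < ε → IsTimeOrdered (linActMulti (planeRot (0 : Fin 3) θ) F) :=
    fun θ hθ => hTF θ (lt_of_lt_of_le hθ hδF')
  have tG : ∀ θ : ℝ, |θ| < ε → IsTimeOrdered (linActMulti (planeRot (0 : Fin 3) θ) G) :=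
    fun θ hθ => hTG θ (lt_of_lt_of_le hθ hδG')
  have nabs : ∀ θ : ℝ, |θ| < ε → |(-θ)| < ε := fun θ hθ => by rwa [abs_neg]
  have eF : ∀ (θ : ℝ) (hθ : |θ| < ε),
      VF (-(θ : ℂ)) = h'.fieldVec n (fun _ => ()) _ (tF (-θ) (nabs θ hθ)) := fun θ hθ => by
    have := hVF (-θ) (lt_of_lt_of_le (nabs θ hθ) hεF') (tF (-θ) (nabs θ hθ))
    push_cast at this
    exact this
  have eF' : ∀ (θ : ℝ) (hθ : |θ| < ε), VF θ = h'.fieldVec n (fun _ => ()) _ (tF θ hθ) :=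
    fun θ hθ => hVF θ (lt_of_lt_of_le hθ hεF') (tF θ hθ)
  have eG : ∀ (θ : ℝ) (hθ : |θ| < ε),
      VG (-(θ : ℂ)) = h'.fieldVec m (fun _ => ()) _ (tG (-θ) (nabs θ hθ)) := fun θ hθ => by
    have := hVG (-θ) (lt_of_lt_of_le (nabs θ hθ) hεG') (tG (-θ) (nabs θ hθ))
    push_cast at this
    exact this
  have eG' : ∀ (θ : ℝ) (hθ : |θ| < ε), VG θ = h'.fieldVec m (fun _ => ()) _ (tG θ hθ) :=
    fun θ hθ => hVG θ (lt_of_lt_of_le hθ hεG') (tG θ hθ)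
  -- the four real-segment Gram identities
  have ip : ∀ θ : ℝ, |θ| < ε → ⟪VF (-(θ : ℂ)), VF θ⟫_ℂ =
      ∑ k ∈ Finset.Icc (-(Kp : ℤ)) Kp, p k * Complex.exp (4 * (k : ℂ) * (θ : ℂ) * Complex.I) :=
    fun θ hθ => by rw [eF θ hθ, eF' θ hθ, ← orbit_eq_inner h' hHFF θ, hp θ]
  have iq : ∀ θ : ℝ, |θ| < ε → ⟪VF (-(θ : ℂ)), VG θ⟫_ℂ =
      ∑ k ∈ Finset.Icc (-(Kq : ℤ)) Kq, q k * Complex.exp (4 * (k : ℂ) * (θ : ℂ) * Complex.I) :=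
    fun θ hθ => by rw [eF θ hθ, eG' θ hθ, ← orbit_eq_inner h' hHFG θ, hq θ]
  have iq' : ∀ θ : ℝ, |θ| < ε → ⟪VG (-(θ : ℂ)), VF θ⟫_ℂ =
      ∑ k ∈ Finset.Icc (-(Kq' : ℤ)) Kq', q' k * Complex.exp (4 * (k : ℂ) * (θ : ℂ) * Complex.I) :=
    fun θ hθ => by rw [eG θ hθ, eF' θ hθ, ← orbit_eq_inner h' hHGF θ, hq' θ]
  have ir : ∀ θ : ℝ, |θ| < ε → ⟪VG (-(θ : ℂ)), VG θ⟫_ℂ =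
      ∑ k ∈ Finset.Icc (-(Kr : ℤ)) Kr, r k * Complex.exp (4 * (k : ℂ) * (θ : ℂ) * Complex.I) :=
    fun θ hθ => by rw [eG θ hθ, eG' θ hθ, ← orbit_eq_inner h' hHGG θ, hr θ]
  exact stub_rayPositivityCore h'.Hilbert ε hε VF VG hVFd' hVGd' Kp Kq Kq' Kr p q q' r ip iq iq' ir
    s hs v w

end RayPositivityLocal

/-- **Stub `stub_rayPositivityLocal` — boosts inherit the mirrors: ray positivity of the doubled
pencils from LOCAL boost vectors.**  Axis rays `s > 0`: `RayPositivityLocal.axis_half` for `S₁`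
and its `e₀`-reconstruction (E2 from the OS package + translations), fed with the boost vectors of
the first local hypothesis; diagonal rays `s < 0`: the same for the `45°` pull-back
`𝔖 ∘ (R_{π/4} ·)` (reflection positive by `EightFrameRP`, translation invariant by transport), fed
with the boost vectors of the second local hypothesis, whose orbit coefficients are `(-1)^k c_k`,
evaluated at `-s > 0`.  Registered signature of the skeleton
`Cruxes/SoftKernelBoostCovariance/Lines/Sketch.lean`, verbatim. -/
theorem stub_rayPositivityLocal :
    open Literature.MathematicalPhysics.QuantumLattice Literature.MathematicalPhysics.AQFT
      Literature.MathematicalPhysics.QuantumFieldTheory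
      Summit.QuantumFields.YangMills.Theorems.CurvatureBoostCovariance.Negative
      Summit.QuantumFields.YangMills.Theorems.NPointIsotropy.Negative in
    ∀ (S₁ : SchwingerFamily E4), OSPackage S₁ → Translations S₁ → EightFrameRP S₁ →
      (∀ (h : OSReconstructionNoE1 S₁.toLabelled), ∀ (n : ℕ) (F : SchwartzMap (Fin n → E4) ℂ), IsTimeOrdered F →
          HasCompactSupport (F : (Fin n → E4) → ℂ) →
          ∃ ε : ℝ, 0 < ε ∧ ∃ (V : ℂ → h.Hilbert) (C N : ℝ),
            DifferentiableOn ℂ V {θ : ℂ | |θ.re| < ε} ∧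
            (∀ θ : ℂ, |θ.re| < ε → ‖V θ‖ ≤ C * Real.exp (N * |θ.im|)) ∧
            ∀ θ : ℝ, |θ| < ε → ∀ hθ : IsTimeOrdered (linActMulti (planeRot (0 : Fin 3) θ) F),
              V θ = h.fieldVec n (fun _ => ()) (linActMulti (planeRot (0 : Fin 3) θ) F) hθ) →
      (∀ (h' : OSReconstructionNoE1 (SchwingerFamily.toLabelled (fun n => (S₁ n).comp (linActMulti (planeRot (0 : Fin 3) (Real.pi / 4)))))),
        ∀ (n : ℕ) (F : SchwartzMap (Fin n → E4) ℂ), IsTimeOrdered F →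
          HasCompactSupport (F : (Fin n → E4) → ℂ) →
          ∃ ε : ℝ, 0 < ε ∧ ∃ (V : ℂ → h'.Hilbert) (C N : ℝ),
            DifferentiableOn ℂ V {θ : ℂ | |θ.re| < ε} ∧
            (∀ θ : ℂ, |θ.re| < ε → ‖V θ‖ ≤ C * Real.exp (N * |θ.im|)) ∧
            ∀ θ : ℝ, |θ| < ε → ∀ hθ : IsTimeOrdered (linActMulti (planeRot (0 : Fin 3) θ) F),
              V θ = h'.fieldVec n (fun _ => ()) (linActMulti (planeRot (0 : Fin 3) θ) F) hθ) →
      ∀ (n m : ℕ) (F : SchwartzMap (Fin n → E4) ℂ) (G : SchwartzMap (Fin m → E4) ℂ),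
        IsTimeOrdered F → IsTimeOrdered G →
        HasCompactSupport (F : (Fin n → E4) → ℂ) → HasCompactSupport (G : (Fin m → E4) → ℂ) →
        ∀ (HFF : SchwartzMap (Fin (n + n) → E4) ℂ) (HFG : SchwartzMap (Fin (n + m) → E4) ℂ)
          (HGF : SchwartzMap (Fin (m + n) → E4) ℂ) (HGG : SchwartzMap (Fin (m + m) → E4) ℂ),
          IsAppendTensorOf HFF (osAdjoint F) F → IsAppendTensorOf HFG (osAdjoint F) G →
          IsAppendTensorOf HGF (osAdjoint G) F → IsAppendTensorOf HGG (osAdjoint G) G →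
        ∀ (Kp Kq Kq' Kr : ℕ) (p q q' r : ℤ → ℂ),
          (∀ θ : ℝ, S₁ (n + n) (linActMulti (planeRot (0 : Fin 3) θ) HFF) =
            ∑ k ∈ Finset.Icc (-(Kp : ℤ)) Kp, p k * Complex.exp (4 * (k : ℂ) * (θ : ℂ) * Complex.I)) →
          (∀ θ : ℝ, S₁ (n + m) (linActMulti (planeRot (0 : Fin 3) θ) HFG) =
            ∑ k ∈ Finset.Icc (-(Kq : ℤ)) Kq, q k * Complex.exp (4 * (k : ℂ) * (θ : ℂ) * Complex.I)) →
          (∀ θ : ℝ, S₁ (m + n) (linActMulti (planeRot (0 : Fin 3) θ) HGF) =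
            ∑ k ∈ Finset.Icc (-(Kq' : ℤ)) Kq', q' k * Complex.exp (4 * (k : ℂ) * (θ : ℂ) * Complex.I)) →
          (∀ θ : ℝ, S₁ (m + m) (linActMulti (planeRot (0 : Fin 3) θ) HGG) =
            ∑ k ∈ Finset.Icc (-(Kr : ℤ)) Kr, r k * Complex.exp (4 * (k : ℂ) * (θ : ℂ) * Complex.I)) →
        ∀ s : ℝ, s ≠ 0 → ∀ v w : ℂ,
          (fun z : ℂ => 0 ≤ z.re ∧ z.im = 0)
            ((∑ k ∈ Finset.Icc (-(Kp : ℤ)) Kp, starRingEnd ℂ v * v * (p k * (s : ℂ) ^ k)) +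
            (∑ k ∈ Finset.Icc (-(Kq : ℤ)) Kq, starRingEnd ℂ v * w * (q k * (s : ℂ) ^ k)) +
            (∑ k ∈ Finset.Icc (-(Kq' : ℤ)) Kq', starRingEnd ℂ w * v * (q' k * (s : ℂ) ^ k)) +
            (∑ k ∈ Finset.Icc (-(Kr : ℤ)) Kr, starRingEnd ℂ w * w * (r k * (s : ℂ) ^ k))) := by
  intro S₁ hOS htr h8 hlocS hlocT n m F G hF hG hFc hGc HFF HFG HGF HGG hHFF hHFG hHGF hHGG
    Kp Kq Kq' Kr p q q' r hp hq hq' hr s hs v w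
  obtain ⟨-, -, -, hRP, -, -⟩ := hOS
  rcases lt_or_gt_of_ne hs with hneg | hpos
  · -- the diagonal rays `s < 0`: the `45°` pull-back at `-s > 0`
    have hT : OSReconstructionNoE1 (SchwingerFamily.toLabelled
        fun n => (S₁ n).comp (linActMulti (planeRot (0 : Fin 3) (Real.pi / 4)))) :=
      osReconstruction_of (isReflectionPositive_pullBack h8) (translations_pullBack htr _)
    have res := RayPositivityLocal.axis_half hT (hlocT hT) hF hG hFc hGc hHFF hHFG hHGF hHGG
      Kp Kq Kq' Kr (fun k => (-1) ^ k * p k) (fun k => (-1) ^ k * q k)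
      (fun k => (-1) ^ k * q' k) (fun k => (-1) ^ k * r k)
      (orbit_pullBack HFF Kp p hp) (orbit_pullBack HFG Kq q hq) (orbit_pullBack HGF Kq' q' hq')
      (orbit_pullBack HGG Kr r hr) (-s) (by linarith) v w
    simp only [twist_cancel] at res
    exact res
  · -- the axis rays `s > 0`
    have h₀ : OSReconstructionNoE1 S₁.toLabelled := osReconstruction_of hRP htr
    exact RayPositivityLocal.axis_half h₀ (hlocS h₀) hF hG hFc hGc hHFF hHFG hHGF hHGG
      Kp Kq Kq' Kr p q q' r hp hq hq' hr s hpos v w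

end Summit.QuantumFields.YangMills.Theorems.SoftKernelBoostCovariance.Sketch

end
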